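import Summits.ABC.IUTFork.Thm311RealInd1StripTwistJWOddBasis
import Summits.ABC.IUTFork.Thm311RealIndTraceInvariant
import Literature.IUT.LogVolume.LogUnitsSubmodule
import HarnessLib

/-!
# [IUTchIII] Thm 3.11 (i) (Ind1)+(Ind2) at `v ∈ 𝕍^non`: the ADDITIVE SPAN OF THE ORBIT of a region under print's single-place indeterminacies —
# confined to `M + c·(log_p(𝒪_v^×) ∩ Ker Tr)` (UNCONDITIONAL), reaching `M + Σ_i C_i(M)·P_i` (modulo `JannsenWingbergTwists`)

PROOF-ONLY file (abc-iut cell, Cor. 3.12 sub-crew, seat abc-iut-c312-1 = holder of record of the typed [IUTchIII] Thm. 3.11, gen 14;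
row «R17 = C:PERIMAGE-PRINT-IND1», part b — the single-place LOWER/UPPER bounds behind the container half `LDHGenuinePerImagePrintInd1`).
TAKES NO SIDE on [IUTchIII] Cor. 3.12.

WHY. The hull gain of [IUTchIII] Cor. 3.12 Step (x) at a tensor packet is governed by the ADDITIVE SPAN of the orbit of the Θ-region
(abc-iut-S2 `packetHull` = the `(R_I)^∼`-span; abc-iut-w5-d180 `Thm311RealIsmDHOrbitSpan`: under Dupuy–Hilado's `Aut_{ℚ_p}(K_v : I_v)` the orbit of ANY
region `M` of content `c` additively generates ALL of `c·log_p(𝒪_v^×)` — transitivity on primitive vectors). Print's single-place group at `v` —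
the (Ind1) strip part `Real.ind1Strip` (R9) and (Ind2) `Real.ismIsm` (R8, `= ℤ_p^×·id`, abc-iut-w5-d216) — is NOT transitive: it preserves the
trace (R13). This file measures its orbit span from both sides, at one finite place `v` of `F`, on abc-iut-S7's rescaled completion
`K_v^{(1/n_v)}` (`RescaledCompletion.of` = the identity):

* §1 (UNCONDITIONAL) `image_range_galoisLog_eq_logUnits` (dictionary `log(𝒪_v^×) ↔ log_p(R^×)`), `sub_mem_smul_logUnits_inter_ker_trace_of_mem_ind1StripOf`,
  `symm_mem_smul_logUnits_of_mem_ind1StripOf`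
  — for `ψ` in print's (Ind1) strip part and `x ∈ c·log_p(𝒪_v^×)` (`c ∈ ℚ_p`): `ψ x − x ∈ c·log_p(𝒪_v^×) ∩ Ker(Tr_{K_v/ℚ_p})` (L-stability R9
  `image_range_eq_of_realises_strip` + `ℚ_p`-linearity by continuity + trace rigidity R13); **`orbit_subset_add_of_mem_closure_ind`** — for EVERY
  `γ` in the subgroup generated by `Real.ind1Strip (analyticLogv F) v ∪ Real.ismIsm (analyticLogv F) v` and every `ℤ_p`-submodule `M ⊆ c·log_p(𝒪_v^×)`:
  `γ(M) ⊆ M + (c·log_p(𝒪_v^×) ∩ Ker Tr)` — the orbit never leaves `M + c·W_v`, `W_v := log_p(𝒪_v^×) ∩ Ker Tr` (CANONICAL); so the additive span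
  of the print-(Ind1)⊔(Ind2) orbit of `M` lies in `M + c·W_v` (it misses the radial direction: the traces it reaches are those of `M`, up to
  units), whereas the DH container's orbit span is all of `c·log_p(𝒪_v^×)`;
* §2 (modulo `JannsenWingbergTwists`, ODD local degree `d ≥ 3`; the even twin is the gen-12 `…JWFirstPlanes` data) **`exists_planes_smul_mem_of_orbit`** —
  with the Jannsen–Wingberg basis `y` of R15a (`Real.exists_realised_basis_trace_of_jannsenWingberg_odd`: Kondo's planes `P_i = ℤ_p y_{(i,0)} ⊕ ℤ_p y_{(i,1)}`,
  `span_{ℚ_p}(planes) = Ker Tr`) and the realised plane transvections `ψ_i, ψ'_i ∈ Real.ind1StripOf v (galoisLog v)`: every additive subgroup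
  `N ⊇ γ(M)` for the FIVE elements `γ ∈ {1, ψ_i, ψ'_i, ψ'_iψ_i, ψ_iψ'_i}` contains `y^*_{(i,ε)}(x)·y_{(i,ε')}` for all `x ∈ M`, `ε, ε'` — i.e.
  `span(orbit) ⊇ M + Σ_i C_i(M)·P_i`, `C_i(M)` the `ℤ`-span of the plane-`i` coordinates of `M` (four commutator-free identities:
  `ψ x − x = y^*_b(x) y_a`, `ψ' x − x = −y^*_a(x) y_b`, `ψ'ψ x − ψ x = −(y^*_a(x) + y^*_b(x)) y_b`, `ψψ' x − ψ' x = (y^*_b(x) − y^*_a(x)) y_a`);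
  the reached vectors are trace-zero (the planes are), consistent with §1.
READING (numbers about OUR typed objects): for hull purposes print's (Ind1) strip part at `v` reaches, modulo Jannsen–Wingberg, the plane lattices
scaled by the plane contents of the region, inside the canonical ceiling `M + c·(log_p(𝒪_v^×) ∩ Ker Tr)`; the gap between the two (the `ℤ_p`-position
of the Jannsen–Wingberg basis inside `log_p(𝒪_v^×)`, and for `d ≥ 5` the mixing of planes — Kondo 2025 §3: the mapping-class-group image `Sp_{2g}(ℤ_p)`,
NOT a fact of the tree) is what remains between print's reading and the container's at a place where the container reading holds; Kondo's open
base-line bit (does `Aut(G_k)` move `y_1`?) is immaterial here, since by §1 no strip automorphism moves anything out of `x + Ker Tr`.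
HONEST SCOPE: §2 conditional on `hJW : JannsenWingbergTwists` (binder); nothing here computes a tensor-packet hull or a log-volume; no side taken on
[IUTchIII] Cor. 3.12; NO abc claim. [claim: Mochizuki2012, status: disputed]; [cite: Kondo2025OuterAutMLF, §2 Thm 2.3, §3 Rem 3.16–3.18];
[cite: HoshiNishio2022OuterAutMLF, Lemma 2.3 (ii)]; [cite: DupuyHilado2025, §4.9, §4.12]; [cite: WeilBNT1967, Ch. II §2, Th. 1]. typed ≠ proved.
-/

set_option autoImplicit false

noncomputable section

open Metric Set
open scoped Pointwise

namespace Summit.ABC.IUTFork.Thm311.Real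

open NumberField IsDedekindDomain Literature.NumberTheory.NumberFields Literature.IUT.LogVolume
open Literature.NumberTheory.GaloisRepresentations Literature.NumberTheory.GaloisRepresentations.Ultrametric
open Literature.AnabelianGeometry.AbsoluteAnabelian Literature.IUT.HodgeArakelov
open Literature.IUT.HodgeArakelov.AbsTopMonoids Literature.IUT.LogThetaLattice

variable {F : Type} [Field F] [NumberField F] (v : HeightOneSpectrum (𝓞 F))

/-! ## 1. UNCONDITIONAL: the orbit of `M ⊆ c·log_p(𝒪_v^×)` under print's (Ind1)⊔(Ind2) stays in `M + c·(log_p(𝒪_v^×) ∩ Ker Tr)` -/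

section Upper

variable (p : ℕ) [hp : Fact p.Prime] (hv : ((p : ℕ) : 𝓞 F) ∈ v.asIdeal)

/-- Dictionary: read in the rescaled completion, the image of the Galois (= analytic) logarithm on `𝒪_v^×` IS campaign-S's `log_p(R^×)`:
`of '' range(galoisLog v) = logUnits (K_v^{(1/n_v)})`. [cite: NeukirchANT1999, Ch. II Prop. (5.5)] -/
theorem image_range_galoisLog_eq_logUnits :
    RescaledCompletion.of F p v hv '' Set.range (galoisLog v) = logUnits (RescaledCompletion F p v hv) := by
  apply Set.Subset.antisymm
  · rintro _ ⟨_, ⟨u, rfl⟩, rfl⟩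
    exact of_galoisLog_mem_logUnits v p hv (Additive.toMul u)
  · intro z hz
    -- `z ∈ log_p(R^×)` lies in the compact `log_p(R^×)`; scale-free argument: `z = unitLog y`, `‖y‖ = 1`, `y` a unit of `𝒪_v`
    obtain ⟨y, hy, hyz⟩ := (mem_logUnits_iff (K := RescaledCompletion F p v hv)).mp hz
    set x : v.adicCompletion F := (RescaledCompletion.of F p v hv).symm y with hx
    have hyx : y = RescaledCompletion.of F p v hv x := by rw [hx, RingEquiv.apply_symm_apply]
    have hx1 : ‖x‖ = 1 := by
      have h := hy
      rw [hyx, RescaledCompletion.norm_of] at h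
      have hpos : 0 < (1 / (localDeg F v : ℝ)) := div_pos one_pos (by exact_mod_cast localDeg_pos F v)
      rcases lt_trichotomy ‖x‖ 1 with hlt | heq | hgt
      · exact absurd h (ne_of_lt (Real.rpow_lt_one (norm_nonneg _) hlt hpos))
      · exact heq
      · exact absurd h (ne_of_gt (Real.one_lt_rpow hgt hpos))
    have hxO : x ∈ v.adicCompletionIntegers F := by
      rw [HeightOneSpectrum.mem_adicCompletionIntegers]
      exact Valued.toNormedField.norm_le_one_iff.mp hx1.le
    have hx0 : x ≠ 0 := by intro h; rw [h, norm_zero] at hx1; exact zero_ne_one hx1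
    have hxiO : x⁻¹ ∈ v.adicCompletionIntegers F := by
      rw [HeightOneSpectrum.mem_adicCompletionIntegers]
      exact Valued.toNormedField.norm_le_one_iff.mp (by rw [norm_inv, hx1, inv_one])
    let u : (↥(v.adicCompletionIntegers F))ˣ :=
      ⟨⟨x, hxO⟩, ⟨x⁻¹, hxiO⟩, Subtype.ext (mul_inv_cancel₀ hx0), Subtype.ext (inv_mul_cancel₀ hx0)⟩
    refine ⟨galoisLog v (Additive.ofMul u), ⟨Additive.ofMul u, rfl⟩, ?_⟩
    rw [galoisLog_apply_eq_unitLog v p hv u, RingEquiv.apply_symm_apply, ← hyz, hyx]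

/-- **L-STABILITY AND TRACE RIGIDITY, difference form (UNCONDITIONAL).** For `ψ` in print's (Ind1) strip part at `v` (over the Galois
logarithm) and `x` with `of x ∈ c·log_p(R^×)` (`c ∈ ℚ_p`): `of(ψ x) − of x ∈ c·log_p(R^×) ∩ Ker(Tr_{K_v/ℚ_p})` — `ψ` maps `log(𝒪_v^×)` onto itself
(R9 `image_range_eq_of_realises_strip`), is `ℚ_p`-linear by continuity (campaign-S `map_padic_smul_of_continuous`), and preserves the trace
(R13 `trace_apply_eq_of_mem_ind1StripOf`). [claim: Mochizuki2012, status: disputed] [cite: HoshiNishio2022OuterAutMLF, Lemma 2.3 (ii) p.7] -/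
theorem sub_mem_smul_logUnits_inter_ker_trace_of_mem_ind1StripOf
    {ψ : v.adicCompletion F ≃+ v.adicCompletion F} (hψ : ψ ∈ ind1StripOf v (galoisLog v)) (c : ℚ_[p])
    {x : v.adicCompletion F}
    (hx : RescaledCompletion.of F p v hv x ∈ c • logUnits (RescaledCompletion F p v hv)) :
    RescaledCompletion.of F p v hv (ψ x) - RescaledCompletion.of F p v hv x ∈
        c • logUnits (RescaledCompletion F p v hv) ∧
      Algebra.trace ℚ_[p] (RescaledCompletion F p v hv)
        (RescaledCompletion.of F p v hv (ψ x) - RescaledCompletion.of F p v hv x) = 0 := by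
  obtain rfl : p = (closureAt v).residueChar := eq_residueChar_closureAt_of_natCast_mem v hv
  set e := RescaledCompletion.of F (closureAt v).residueChar v hv with he
  obtain ⟨hcont, _, φ, hreal⟩ := id hψ
  -- `ψ` read on the rescaled completion, `ℚ_p`-linear by continuity
  let f : RescaledCompletion F (closureAt v).residueChar v hv →+ RescaledCompletion F (closureAt v).residueChar v hv :=
    { toFun := fun a => e (ψ (e.symm a))
      map_zero' := by rw [map_zero, map_zero, map_zero]
      map_add' := fun a b => by rw [map_add, map_add, map_add] }
  have hfc : Continuous f := hcont
  have hf_smul : ∀ (a : ℚ_[(closureAt v).residueChar]) (z : RescaledCompletion F (closureAt v).residueChar v hv),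
      f (a • z) = a • f z := fun a z => map_padic_smul_of_continuous (closureAt v).residueChar f hfc a z
  -- `f` maps `log_p(R^×)` onto itself
  have hΛ : f '' logUnits (RescaledCompletion F (closureAt v).residueChar v hv) =
      logUnits (RescaledCompletion F (closureAt v).residueChar v hv) := by
    rw [← image_range_galoisLog_eq_logUnits v (closureAt v).residueChar hv, Set.image_image]
    have h1 : (fun a => f (e a)) '' Set.range (galoisLog v) = e '' (ψ '' Set.range (galoisLog v)) := by
      rw [Set.image_image]
      refine Set.image_congr fun a _ => ?_
      show e (ψ (e.symm (e a))) = e (ψ a)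
      rw [e.symm_apply_apply]
    rw [h1, image_range_eq_of_realises_strip v (galoisLog v) hreal]
  refine ⟨?_, ?_⟩
  · -- `of(ψ x) − of x = f(c•z) − c•z = c•(f z − z)` with `z ∈ log_p(R^×)`
    obtain ⟨z, hz, hzx⟩ := Set.mem_smul_set.mp hx
    have hfx : e (ψ x) = f (e x) := by
      show e (ψ x) = e (ψ (e.symm (e x)))
      rw [e.symm_apply_apply]
    rw [hfx, ← hzx, hf_smul, ← smul_sub]
    refine Set.smul_mem_smul_set ?_
    have hfz : f z ∈ logUnits (RescaledCompletion F (closureAt v).residueChar v hv) := by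
      rw [← hΛ]; exact Set.mem_image_of_mem f hz
    exact (logUnitsAddSubgroup (closureAt v).residueChar (RescaledCompletion F (closureAt v).residueChar v hv)).sub_mem
      (show f z ∈ logUnitsAddSubgroup _ _ from hfz) (show z ∈ logUnitsAddSubgroup _ _ from hz)
  · rw [map_sub, sub_eq_zero]
    exact trace_apply_eq_of_mem_ind1StripOf v hψ x


/-- Companion of the previous lemma for the INVERSE of a strip automorphism: `ψ⁻¹` maps `c·log_p(R^×)` into itself too
(`ψ(log 𝒪_v^×) = log 𝒪_v^×` is a set equality, and `ψ⁻¹` is continuous, hence `ℚ_p`-linear). [claim: Mochizuki2012, status: disputed] -/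
theorem symm_mem_smul_logUnits_of_mem_ind1StripOf
    {ψ : v.adicCompletion F ≃+ v.adicCompletion F} (hψ : ψ ∈ ind1StripOf v (galoisLog v)) (c : ℚ_[p])
    {x : v.adicCompletion F}
    (hx : RescaledCompletion.of F p v hv x ∈ c • logUnits (RescaledCompletion F p v hv)) :
    RescaledCompletion.of F p v hv (ψ.symm x) ∈ c • logUnits (RescaledCompletion F p v hv) := by
  set e := RescaledCompletion.of F p v hv with he
  obtain ⟨-, hcont', φ, hreal⟩ := id hψ
  let f : RescaledCompletion F p v hv →+ RescaledCompletion F p v hv :=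
    { toFun := fun a => e (ψ.symm (e.symm a))
      map_zero' := by rw [map_zero, map_zero, map_zero]
      map_add' := fun a b => by rw [map_add, map_add, map_add] }
  have hfc : Continuous f := hcont'
  have hf_smul : ∀ (a : ℚ_[p]) (z : RescaledCompletion F p v hv), f (a • z) = a • f z :=
    fun a z => map_padic_smul_of_continuous p f hfc a z
  have hΛ : f '' logUnits (RescaledCompletion F p v hv) = logUnits (RescaledCompletion F p v hv) := by
    rw [← image_range_galoisLog_eq_logUnits v p hv, Set.image_image]
    have h1 : (fun a => f (e a)) '' Set.range (galoisLog v) = e '' (ψ.symm '' Set.range (galoisLog v)) := by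
      rw [Set.image_image]
      refine Set.image_congr fun a _ => ?_
      show e (ψ.symm (e.symm (e a))) = e (ψ.symm a)
      rw [e.symm_apply_apply]
    have h2 : ψ.symm '' Set.range (galoisLog v) = Set.range (galoisLog v) := by
      have h := congrArg (fun S => ⇑ψ.symm '' S) (image_range_eq_of_realises_strip v (galoisLog v) hreal)
      simp only [Set.image_image, AddEquiv.symm_apply_apply, Set.image_id'] at h
      exact h.symm
    rw [h1, h2]
  obtain ⟨z, hz, hzx⟩ := Set.mem_smul_set.mp hx
  have hfx : e (ψ.symm x) = f (e x) := by
    show e (ψ.symm x) = e (ψ.symm (e.symm (e x)))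
    rw [e.symm_apply_apply]
  rw [hfx, ← hzx, hf_smul]
  refine Set.smul_mem_smul_set ?_
  rw [← hΛ]; exact Set.mem_image_of_mem f hz

/-- **THE ORBIT OF A REGION UNDER PRINT's (Ind1)⊔(Ind2) AT `v` NEVER LEAVES `M + c·(log_p(R^×) ∩ Ker Tr)` (UNCONDITIONAL).**
For every `γ` in the subgroup of `Aut_ℚ(K_v)` generated by print's (Ind1) strip part `Real.ind1Strip (analyticLogv F) v` and print's (Ind2)
`Real.ismIsm (analyticLogv F) v`, every `c ∈ ℚ_p`, and every `ℤ_p`-stable additive subgroup `M ⊆ c·log_p(R^×)` of `K_v^{(1/n_v)}` (a region of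
content `c`: an ideal-shaped Θ-region `q^{j²}·𝒪_v ⊆ p^k·log_p(𝒪_v^×)`, say): `γ(M) ⊆ M + (c·log_p(R^×) ∩ Ker(Tr_{K_v/ℚ_p}))`. So the ADDITIVE SPAN
of the whole print-(Ind1)⊔(Ind2) orbit of `M` lies in `M + c·W_v`, `W_v = log_p(𝒪_v^×) ∩ Ker Tr` — it can only add TRACE-ZERO log-units of the
same content — whereas Dupuy–Hilado's `Aut_{ℚ_p}(K_v : I_v)` generates all of `c·log_p(𝒪_v^×)` from any region of content `c` (abc-iut-w5-d180
`exists_closure_iUnion_ismDH_image_eq`). Invariant carried through the group: `γ x = u·x + w`, `‖u‖ = 1`, `w ∈ c·log_p(R^×) ∩ Ker Tr`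
(strip generators and their inverses: `u = 1` by L-stability + trace rigidity; Ism generators: `w = 0`, abc-iut-w5-d216's unit scalars).
[claim: Mochizuki2012, status: disputed] [cite: HoshiNishio2022OuterAutMLF, Lemma 2.3 (ii) p.7] [cite: DupuyHilado2025, §4.9] -/
theorem orbit_subset_add_of_mem_closure_ind
    {γ : Carrier (.inr v : Place F) ≃ₗ[ℚ] Carrier (.inr v : Place F)}
    (hγ : γ ∈ Subgroup.closure (ind1Strip (analyticLogv F) v ∪ ismIsm (analyticLogv F) v)) (c : ℚ_[p])
    (M : AddSubgroup (RescaledCompletion F p v hv))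
    (hMs : ∀ u : ℚ_[p], ‖u‖ ≤ 1 → ∀ z ∈ M, u • z ∈ M)
    (hM : (M : Set (RescaledCompletion F p v hv)) ⊆ c • logUnits (RescaledCompletion F p v hv))
    {x : v.adicCompletion F} (hx : RescaledCompletion.of F p v hv x ∈ M) :
    RescaledCompletion.of F p v hv (γ x) ∈
      (M : Set (RescaledCompletion F p v hv)) +
        (c • logUnits (RescaledCompletion F p v hv) ∩
          {w | Algebra.trace ℚ_[p] (RescaledCompletion F p v hv) w = 0}) := by
  obtain rfl : p = (closureAt v).residueChar := eq_residueChar_closureAt_of_natCast_mem v hv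
  set e := RescaledCompletion.of F (closureAt v).residueChar v hv with he
  set R := RescaledCompletion F (closureAt v).residueChar v hv
  set L : Set R := logUnits R with hL
  set Tr := Algebra.trace ℚ_[(closureAt v).residueChar] R with hTr
  -- bookkeeping on `c·L ∩ Ker Tr`
  have hL0 : (0 : R) ∈ L := zero_mem_logUnits (p := (closureAt v).residueChar)
  have hcL_add : ∀ a b : R, a ∈ c • L → b ∈ c • L → a + b ∈ c • L := by
    intro a b ha hb
    obtain ⟨a', ha', rfl⟩ := Set.mem_smul_set.mp ha
    obtain ⟨b', hb', rfl⟩ := Set.mem_smul_set.mp hb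
    rw [← smul_add]
    exact Set.smul_mem_smul_set
      ((logUnitsAddSubgroup (closureAt v).residueChar R).add_mem (show a' ∈ logUnitsAddSubgroup _ R from ha')
        (show b' ∈ logUnitsAddSubgroup _ R from hb'))
  have hcL_neg : ∀ a : R, a ∈ c • L → -a ∈ c • L := by
    intro a ha
    obtain ⟨a', ha', rfl⟩ := Set.mem_smul_set.mp ha
    rw [← smul_neg]
    exact Set.smul_mem_smul_set
      ((logUnitsAddSubgroup (closureAt v).residueChar R).neg_mem (show a' ∈ logUnitsAddSubgroup _ R from ha'))
  have hcL_smul : ∀ (u : ℚ_[(closureAt v).residueChar]) (a : R), ‖u‖ ≤ 1 → a ∈ c • L → u • a ∈ c • L := by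
    intro u a hu ha
    obtain ⟨a', ha', rfl⟩ := Set.mem_smul_set.mp ha
    rw [smul_comm]
    refine Set.smul_mem_smul_set ?_
    -- `ℤ_p`-stability of `log_p(R^×)` (campaign-S `smul_mem_logUnits`)
    set u' : ℤ_[(closureAt v).residueChar] := ⟨u, hu⟩ with hu'
    have h := smul_mem_logUnits (closureAt v).residueChar R u' ha'
    rw [← algebraMap_smul ℚ_[(closureAt v).residueChar] u' a'] at h
    exact h
  -- the invariant: `e(γ x) = u • e x + w`, `‖u‖ = 1`, `w ∈ c·L ∩ Ker Tr`, for all `x` with `e x ∈ c·L`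
  have key : ∃ u : ℚ_[(closureAt v).residueChar], ‖u‖ = 1 ∧ ∀ x : v.adicCompletion F, e x ∈ c • L →
      e (γ x) - u • e x ∈ c • L ∧ Tr (e (γ x) - u • e x) = 0 := by
    induction hγ using Subgroup.closure_induction'' with
    | mem δ hδ =>
      rcases hδ with hδ | hδ
      · refine ⟨1, norm_one, fun x hx => ?_⟩
        rw [one_smul]
        have h := (mem_ind1Strip_iff (analyticLogv F) v δ).mp hδ
        rw [← galoisLog_eq_analyticLogv v] at h
        exact sub_mem_smul_logUnits_inter_ker_trace_of_mem_ind1StripOf v (closureAt v).residueChar hv h c hx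
      · obtain ⟨u, hu1, hu⟩ := exists_unit_scalar_of_mem_ismIsm_analyticLogv (closureAt v).residueChar v hv hδ
        refine ⟨u, hu1, fun x _ => ?_⟩
        rw [show e (δ x) = u • e x from hu x, sub_self, map_zero]
        exact ⟨by rw [← smul_zero c]; exact Set.smul_mem_smul_set hL0, rfl⟩
    | inv_mem δ hδ =>
      rcases hδ with hδ | hδ
      · refine ⟨1, norm_one, fun x hx => ?_⟩
        rw [one_smul]
        have h := (mem_ind1Strip_iff (analyticLogv F) v δ).mp hδ
        rw [← galoisLog_eq_analyticLogv v] at h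
        -- `x = δ b` with `b = δ⁻¹ x`, `e b ∈ c·L`
        have hb : e (δ⁻¹ x) ∈ c • L :=
          symm_mem_smul_logUnits_of_mem_ind1StripOf v (closureAt v).residueChar hv h c hx
        have h2 : e (δ (δ⁻¹ x)) - e (δ⁻¹ x) ∈ c • L ∧ Tr (e (δ (δ⁻¹ x)) - e (δ⁻¹ x)) = 0 :=
          sub_mem_smul_logUnits_inter_ker_trace_of_mem_ind1StripOf v (closureAt v).residueChar hv h c hb
        rw [show δ (δ⁻¹ x) = x from δ.apply_symm_apply x] at h2
        refine ⟨?_, ?_⟩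
        · have := hcL_neg _ h2.1
          rwa [neg_sub] at this
        · rw [← neg_sub, map_neg, h2.2, neg_zero]
      · obtain ⟨u, hu1, hu⟩ := exists_unit_scalar_of_mem_ismIsm_analyticLogv (closureAt v).residueChar v hv hδ
        have hu0 : u ≠ 0 := norm_ne_zero_iff.mp (by rw [hu1]; exact one_ne_zero)
        refine ⟨u⁻¹, by rw [norm_inv, hu1, inv_one], fun x _ => ?_⟩
        have h1 : e x = u • e (δ⁻¹ x) := by
          have := hu (δ⁻¹ x)
          rwa [show δ (δ⁻¹ x) = x from δ.apply_symm_apply x] at this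
        rw [h1, smul_smul, inv_mul_cancel₀ hu0, one_smul, sub_self, map_zero]
        exact ⟨by rw [← smul_zero c]; exact Set.smul_mem_smul_set hL0, rfl⟩
    | one =>
      refine ⟨1, norm_one, fun x _ => ?_⟩
      rw [show (1 : Carrier (.inr v : Place F) ≃ₗ[ℚ] Carrier (.inr v : Place F)) x = x from rfl, one_smul, sub_self,
        map_zero]
      exact ⟨by rw [← smul_zero c]; exact Set.smul_mem_smul_set hL0, rfl⟩
    | mul δ₁ δ₂ _ _ h₁ h₂ =>
      obtain ⟨u₁, hu₁, h₁⟩ := h₁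
      obtain ⟨u₂, hu₂, h₂⟩ := h₂
      refine ⟨u₁ * u₂, by rw [norm_mul, hu₁, hu₂, one_mul], fun x hx => ?_⟩
      obtain ⟨h2L, h2T⟩ := h₂ x hx
      have hx2 : e (δ₂ x) ∈ c • L := by
        have : e (δ₂ x) = (e (δ₂ x) - u₂ • e x) + u₂ • e x := by abel
        rw [this]
        exact hcL_add _ _ h2L (hcL_smul u₂ _ hu₂.le hx)
      obtain ⟨h1L, h1T⟩ := h₁ (δ₂ x) hx2
      have hsplit : e ((δ₁ * δ₂) x) - (u₁ * u₂) • e x =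
          (e (δ₁ (δ₂ x)) - u₁ • e (δ₂ x)) + u₁ • (e (δ₂ x) - u₂ • e x) := by
        rw [LinearEquiv.mul_apply, smul_sub, smul_smul]; abel
      rw [hsplit]
      refine ⟨hcL_add _ _ h1L (hcL_smul u₁ _ hu₁.le h2L), ?_⟩
      rw [map_add, map_smul, h1T, h2T, smul_zero, add_zero]
  -- conclude
  obtain ⟨u, hu1, hkey⟩ := key
  obtain ⟨hwL, hwT⟩ := hkey x (hM hx)
  refine ⟨u • e x, hMs u hu1.le _ hx, e (γ x) - u • e x, ⟨hwL, hwT⟩, ?_⟩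
  abel

end Upper

/-! ## 2. Modulo `JannsenWingbergTwists`: the realised plane transvections reach `M + Σ_i C_i(M)·P_i` -/

section Lower

/-- **THE ORBIT SPAN OF PRINT's (Ind1) STRIP PART REACHES THE PLANE LATTICES (modulo `JannsenWingbergTwists`), ODD local degree.**  At `v ∣ p`
odd with `d = [K_v : ℚ_p] ≥ 3` ODD there are — R15a `Real.exists_realised_basis_trace_of_jannsenWingberg_odd` BY NAME — `g` with `d = 1 + 2g`, the
Jannsen–Wingberg `ℚ_p`-basis `y : Fin 1 ⊕ Fin g × Fin 2` of `K_v^{(1/n_v)}` with Kondo's planes `(y_{(i,0)}, y_{(i,1)})` trace-zero and spanning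
`Ker(Tr_{K_v/ℚ_p})`, `Tr(y_{inl 0}) ≠ 0`, and plane transvections `ψ_i : x ↦ x + y^*_{(i,1)}(x)·y_{(i,0)}`, `ψ'_i : x ↦ x − y^*_{(i,0)}(x)·y_{(i,1)}`
REALISED in print's (Ind1) strip part `Real.ind1StripOf v (galoisLog v)`, such that: for every subset `M ⊆ K_v` and every additive subgroup `N` of
`K_v^{(1/n_v)}` containing the images of `M` under the FIVE strip elements `1, ψ_i, ψ'_i, ψ'_i ∘ ψ_i, ψ_i ∘ ψ'_i`, and every `x ∈ M`, `i`, `ε, ε'`: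
`y^*_{(i,ε)}(x)·y_{(i,ε')} ∈ N` — i.e. the additive span of the strip orbit of `M` contains `M + Σ_i C_i(M)·P_i`, `P_i = ℤ y_{(i,0)} + ℤ y_{(i,1)}`
scaled by the plane-`i` coordinates `C_i(M)` of `M` (four identities: `ψ x − x = y^*_b(x) y_a`, `ψ' x − x = −y^*_a(x) y_b`,
`ψ'ψ x − ψ x = −(y^*_a(x) + y^*_b(x)) y_b`, `ψψ' x − ψ' x = (y^*_b(x) − y^*_a(x)) y_a`).  All reached vectors are trace-zero (the planes are),
as §1 demands.  The EVEN-degree twin reads the same identities off gen 12's `Thm311RealInd1StripTwistJWFirstPlanes`.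
[claim: Mochizuki2012, status: disputed] [cite: Kondo2025OuterAutMLF, §2 Thm 2.3 and proof p.10, §3 Rem 3.16] [cite: JannsenWingberg1982, §5.1 p.96]
[cite: HoshiNishio2022OuterAutMLF, Lemma 2.3 (ii) p.7] -/
theorem exists_planes_smul_mem_of_orbit (hJW : JannsenWingbergTwists)
    (p : ℕ) [Fact p.Prime] (hv : ((p : ℕ) : 𝓞 F) ∈ v.asIdeal) (hp2 : p ≠ 2) (h3 : 3 ≤ localDeg F v) (hodd : Odd (localDeg F v)) :
    ∃ (g : ℕ) (_ : localDeg F v = 1 + 2 * g) (y : Module.Basis (Fin 1 ⊕ Fin g × Fin 2) ℚ_[p] (RescaledCompletion F p v hv))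
      (ψ ψ' : Fin g → (v.adicCompletion F ≃+ v.adicCompletion F)),
      (∀ i, ψ i ∈ ind1StripOf v (galoisLog v)) ∧ (∀ i, ψ' i ∈ ind1StripOf v (galoisLog v)) ∧
      (∀ iε : Fin g × Fin 2, Algebra.trace ℚ_[p] (RescaledCompletion F p v hv) (y (Sum.inr iε)) = 0) ∧
      Submodule.span ℚ_[p] (Set.range fun iε : Fin g × Fin 2 => y (Sum.inr iε)) =
        LinearMap.ker (Algebra.trace ℚ_[p] (RescaledCompletion F p v hv)) ∧
      Algebra.trace ℚ_[p] (RescaledCompletion F p v hv) (y (Sum.inl 0)) ≠ 0 ∧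
      ∀ (M : Set (v.adicCompletion F)) (N : AddSubgroup (RescaledCompletion F p v hv)),
        (∀ x ∈ M, RescaledCompletion.of F p v hv x ∈ N) →
        (∀ i, ∀ x ∈ M, RescaledCompletion.of F p v hv (ψ i x) ∈ N ∧ RescaledCompletion.of F p v hv (ψ' i x) ∈ N ∧
          RescaledCompletion.of F p v hv (ψ' i (ψ i x)) ∈ N ∧ RescaledCompletion.of F p v hv (ψ i (ψ' i x)) ∈ N) →
        ∀ i, ∀ x ∈ M, ∀ ε ε' : Fin 2,
          y.coord (Sum.inr (i, ε)) (RescaledCompletion.of F p v hv x) • y (Sum.inr (i, ε')) ∈ N := by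
  obtain ⟨g, hg, y, ψ, ψ', hψ, hψ', hT, hT', htr0, hspan, htr1⟩ :=
    exists_realised_basis_trace_of_jannsenWingberg_odd v hJW p hv hp2 h3 hodd
  refine ⟨g, hg, y, ψ, ψ', hψ, hψ', htr0, hspan, htr1, fun M N hMN horb i x hx ε ε' => ?_⟩
  set e := RescaledCompletion.of F p v hv with he
  obtain ⟨z, hz⟩ : ∃ z, e x = z := ⟨_, rfl⟩
  obtain ⟨α, hα⟩ : ∃ α, y.coord (Sum.inr (i, 0)) z = α := ⟨_, rfl⟩
  obtain ⟨β, hβ⟩ : ∃ β, y.coord (Sum.inr (i, 1)) z = β := ⟨_, rfl⟩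
  have hcoord : ∀ s t : Fin 1 ⊕ Fin g × Fin 2, y.coord s (y t) = if t = s then 1 else 0 := by
    intro s t
    rw [Module.Basis.coord_apply, Module.Basis.repr_self, Finsupp.single_apply]
  have h10 : (Sum.inr (i, (1 : Fin 2)) : Fin 1 ⊕ Fin g × Fin 2) ≠ Sum.inr (i, 0) := by simp
  have h01 : (Sum.inr (i, (0 : Fin 2)) : Fin 1 ⊕ Fin g × Fin 2) ≠ Sum.inr (i, 1) := by simp
  obtain ⟨hNψ, hNψ', hNψ'ψ, hNψψ'⟩ := horb i x hx
  have hzN : z ∈ N := hz ▸ hMN x hx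
  -- the four images, read in the rescaled completion
  have e1 : e (ψ i x) = z + β • y (Sum.inr (i, 0)) := by
    have h := hT i z
    rwa [← hz, RingEquiv.symm_apply_apply, hz, hβ] at h
  have e2 : e (ψ' i x) = z - α • y (Sum.inr (i, 1)) := by
    have h := hT' i z
    rwa [← hz, RingEquiv.symm_apply_apply, hz, hα] at h
  have e3 : e (ψ' i (ψ i x)) = (z + β • y (Sum.inr (i, 0))) - (α + β) • y (Sum.inr (i, 1)) := by
    have h := hT' i (e (ψ i x))
    rw [RingEquiv.symm_apply_apply, e1, map_add, map_smul, hα, hcoord, if_pos rfl, smul_eq_mul, mul_one] at h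
    exact h
  have e4 : e (ψ i (ψ' i x)) = (z - α • y (Sum.inr (i, 1))) + (β - α) • y (Sum.inr (i, 0)) := by
    have h := hT i (e (ψ' i x))
    rw [RingEquiv.symm_apply_apply, e2, map_sub, map_smul, hβ, hcoord, if_pos rfl, smul_eq_mul, mul_one] at h
    exact h
  -- the four reached vectors
  have hβa : β • y (Sum.inr (i, 0)) ∈ N := by
    have h := N.sub_mem hNψ hzN
    rwa [e1, add_sub_cancel_left] at h
  have hαb : α • y (Sum.inr (i, 1)) ∈ N := by
    have h := N.sub_mem hzN hNψ'
    rwa [e2, sub_sub_cancel] at h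
  have hβb : β • y (Sum.inr (i, 1)) ∈ N := by
    have h := N.sub_mem hNψ hNψ'ψ
    rw [e3, e1] at h
    have h' : (α + β) • y (Sum.inr (i, 1)) ∈ N := by convert h using 1; abel
    have h'' := N.sub_mem h' hαb
    rwa [add_smul, add_sub_cancel_left] at h''
  have hαa : α • y (Sum.inr (i, 0)) ∈ N := by
    have h := N.sub_mem hNψψ' hNψ'
    rw [e4, e2] at h
    have h' : (β - α) • y (Sum.inr (i, 0)) ∈ N := by convert h using 1; abel
    have h'' := N.sub_mem hβa h'
    rwa [sub_smul, sub_sub_cancel] at h''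
  rw [hz]
  revert ε ε'
  simp only [Fin.forall_fin_two]
  rw [hα, hβ]
  exact ⟨⟨hαa, hαb⟩, hβa, hβb⟩

end Lower

end Summit.ABC.IUTFork.Thm311.Real

end
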